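import Mathlib
import Literature.Analysis.Complex.RungeUnits
import Literature.Analysis.Complex.RungeBoxes
import Literature.MathematicalPhysics.QuantumFieldTheory.Balaban1983to89.B7Transfer

/-!
# `Balaban1983to89.B9Eq335Plaquette` — B9 (3.35) ⇒ B7 (52) at ratio `ξ = L^{-j}`: the plaquette step (T-G19, B9 half)

CITATION HEADER (lean-in-tree rule 2026-08-18).  Reproduction of ONE implicit bookkeeping step of
T. Bałaban, *Propagators for lattice gauge theories in a background field*, Comm. Math. Phys. **99**,
389–434 (1985) [Balaban1985BackgroundPropagators] (cell paper B9; `paper:balaban1985-cmp99-background-propagators`,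
journal page = PDF page + 388), Sect. B p. 401, read against
T. Bałaban, *Averaging operations for lattice gauge theories*, Comm. Math. Phys. **98**, 17–51 (1985)
[Balaban1985Averaging] (cell paper B7 = B9's reference [5]; journal page = PDF page + 16), p. 26.
Both papers are UNDER ADJUDICATION by the audit cell `pub-balaban`; nothing of them is asserted here.
Pages re-read as IMAGES 2026-08-19 by unit b2b-balaban-b09-g7 (renders `render/b9-08.png` = p. 396,
`render/b9-09.png` = p. 397, `render/b9-13.png` = p. 401, `render/b7-10.png` = B7 p. 26).
Census rows: GAPS C-b07g7-3 (the B7 half of G-tmpl11-1 = TEMPLATE T-G19, which hands the item H1 below to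
the b09 lineage), GAPS C-B9-42 (this file), DIVERGENCE D-b09.33.

## What is printed

B9 p. 396, the regularity condition on the background `U` (verbatim):
"for an arbitrary cube □ of the described above class, and for a configuration U there exists a gauge
transformation u on □ such that U^u = e^{iηA}. and if the index of □ is j, then
|A| < O(1)Mα₀(L^jη)^{-1}, |∇^ηA| < O(1)Mα₀(L^jη)^{-2} on □, where O(1)M is a size of □ in T_{L^{-j}}; (3.35)"
(v1.1 DOCFIX: the lattice symbol is `T_{L^{-j}}` — `L` to the power `−j` — re-read at 300 dpi; v1 printed `T_{L-j}`).
B9 p. 397, Theorem 3.1: "… for M ≧ M₁ and for an arbitrary configuration U satisfying the regularity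
condition (3.35) with Mα₀ ≦ a₀ …".
B9 p. 401 (after (3.57)): "Let us notice that the above expressions involve the gauge field variables
U′_b, U_b for b ⊂ B^j(y). … Taking A′ = L^jηA we have U′ = e^{iξA′}, ξ = L^{-j}, |A′| < α₁. Applying the
inequalities (161), (162) [5], we have … By Proposition 4 [5] the expression on the right-hand side of
(3.57) is an analytic function of A".
B7 p. 26 (verbatim): "To get some small number yet, we have to assume that |U(∂p) − 1| < α₀η², η = L^{-k} (52)
on some set of plaquettes." and Proposition 2: "If U satisfies (52) with α₀ ≦ c₂ = min{1/(3C₀), ½c₂′}, then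
|Ū^k(∂p) − 1| < α₀ + 2C₀α₀² < 2α₀, p ⊂ Ω^{(k)}. (54)  The result is local in the sense that if p = ⟨x, y, z, w⟩,
then it is enough to assume (52) for p ⊂ B^k(x) ∪ B^k(y) ∪ B^k(z) ∪ B^k(w)."

## The implicit step (GAPS C-b07g7-3, hand-off H1)

B7's Propositions 2–4 and (161)–(163), which B9 p. 401 invokes for the `j`-fold averages of `U′U` on
`B^j(y)`, presuppose that the BACKGROUND satisfies B7 (52) at B7's ratio `η_{B7} = L^{-k}`; under B9's
dictionary (`k ↦ j`, `η_{B7} ↦ ξ = L^{-j}`, B9's `η`-lattice rescaled by `(L^jη)^{-1}`) this is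
`|U(∂p) − 1| < α₀′ ξ²` for the `η`-plaquettes `p` in `B^j(y)`.  B9 never states it; it follows from (3.35)
on a cube □ of index `j` containing `B^j(y)`: in the gauge `u`, with bond variables `X_b = iηA_b`,
`U(∂p) = e^{X₁} e^{X₂} e^{-X₃} e^{-X₄}` (`X₁ = iηA_μ(x)`, `X₂ = iηA_ν(x+ηe_μ)`, `X₃ = iηA_μ(x+ηe_ν)`, `X₄ = iηA_ν(x)`),
`‖X_b‖ ≤ η·O(1)Mα₀(L^jη)^{-1} = C ξ` and `‖X₁ − X₃‖ = η²|(∇_νA_μ)(x)| ≤ C ξ²`, `‖X₂ − X₄‖ ≤ C ξ²` with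
`C = O(1)Mα₀`; hence (this file) `‖U(∂p) − 1‖ ≤ 2C(1 + C)e^{4C}·ξ²`, i.e. B7 (52) at ratio `ξ` with
`α₀′ = 2C(1 + C)e^{4C} = O(1)Mα₀(1 + O(1)Mα₀)`, small under Theorem 3.1's "Mα₀ ≦ a₀"; and `|U(∂p) − 1|` is
gauge invariant (`norm_conj_sub_one_eq`), so the gauge `u` of (3.35) is immaterial.

## What is certified here (kernel), and what is not

* §1 (any normed ring): the plaquette identity `u₁u₂u₃′u₄′ − 1 = ((u₁ − u₃)u₂ + u₃(u₂ − u₄) + [u₃, u₄])·u₃′u₄′`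
  for `u₃u₃′ = 1 = u₄u₄′`, the commutator shift `[u₃, u₄] = [u₃ − 1, u₄ − 1]`, the norm bounds
  `norm_plaq_sub_one_le` (general) and `norm_plaq_sub_one_le_of_norm_le_one` (factors of norm `≤ 1`:
  `‖u₁u₂u₃′u₄′ − 1‖ ≤ ‖u₁ − u₃‖ + ‖u₂ − u₄‖ + 2‖u₃ − 1‖‖u₄ − 1‖`), gauge invariance of `‖U(∂p) − 1‖`
  under unit-norm conjugation (`norm_conj_sub_one_eq`, from b07-g3's `B7Transfer.norm_conj_sub_one_le`), and the
  covariant-vs-ordinary difference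
  `‖u a u′ − a‖ ≤ 2‖u − 1‖‖a‖‖u′‖` (`norm_conj_sub_self_le`; relevant if the `∇^η` of (3.35) is read as the
  covariant derivative of (3.39) — the two readings of `|∇^ηA|` differ by `≤ 2η^{-1}(e^{η|A|} − 1)|A|`,
  of the same order `C²(L^jη)^{-2}` as the commutator term).
* §2 (complete normed `ℂ`-algebra with `‖1‖ = 1`, e.g. `G ⊂ G^c ⊂ M_n(ℂ)`): with `u_i = exp X_i`,
  `u_i′ = exp(−X_i)` and NO unitarity hypothesis (so it covers B9's complexified configurations as well):
  `‖e^{X₁}e^{X₂}e^{-X₃}e^{-X₄} − 1‖ ≤ 2(δ + s²)e^{4s}` whenever `‖X_i‖ ≤ s`, `‖X₁ − X₃‖, ‖X₂ − X₄‖ ≤ δ`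
  (`norm_plaquette_exp_sub_one_le`), using the tree's folklore lemmas
  `Literature.Analysis.Complex.norm_exp_sub_exp_le` / `norm_exp_le_exp_norm` (RungeUnits) and
  `Literature.Analysis.Complex.exp_mul_exp_neg` (RungeBoxes).
* §3 the B9 ⇒ B7 arithmetic: `s = Cξ`, `δ = Cξ²`, `0 ≤ ξ ≤ 1` give `≤ 2C(1 + C)e^{4C}·ξ²`
  (`b7_52_of_b9_335`), and the bond dictionary `‖iηa‖ = η‖a‖`, `‖iηa₁ − iηa₃‖ = η²‖η^{-1}(a₃ − a₁)‖`
  (`norm_bond`, `norm_bond_sub`).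
* NOT certified (located, GAPS C-B9-42): the GEOMETRIC covering fact that every `B^j(y)`, `y ∈ Λ_j`,
  together with the plaquettes B7's locality sentence needs, lies in a cube □ of index `j` of the class on
  which (3.35) is imposed (B9 (3.16) and the sequence-of-domains conditions; STILL-OPEN (e) of the b09
  lineage); the thresholds `α₀′ ≤ c₂, c₄` of B7 versus B9's "Mα₀ ≦ a₀" (d, L-only constants on both sides);
  nothing of B7's Propositions 2–4 themselves (b07 lineage: `B7Prop6Bound`, `B7Transfer`).

Value = kernel discharge of one implicit by-reference hypothesis (arithmetic only), NOT summit progress.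
-/

namespace Literature.MathematicalPhysics.QuantumFieldTheory.Balaban1983to89.B9Eq335Plaquette

/-! ## §1  Plaquette algebra in a normed ring -/

section Ring

variable {𝔸 : Type*} [NormedRing 𝔸]

/-- `[u, v] = [u − 1, v − 1]`. [folklore] -/
theorem comm_eq_comm_sub_one (u v : 𝔸) :
    u * v - v * u = (u - 1) * (v - 1) - (v - 1) * (u - 1) := by
  noncomm_ring

/-- `‖[u, v]‖ ≤ 2‖u − 1‖‖v − 1‖`. [folklore] -/
theorem norm_comm_le (u v : 𝔸) : ‖u * v - v * u‖ ≤ 2 * ‖u - 1‖ * ‖v - 1‖ := by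
  rw [comm_eq_comm_sub_one]
  calc ‖(u - 1) * (v - 1) - (v - 1) * (u - 1)‖
      ≤ ‖(u - 1) * (v - 1)‖ + ‖(v - 1) * (u - 1)‖ := norm_sub_le _ _
    _ ≤ ‖u - 1‖ * ‖v - 1‖ + ‖v - 1‖ * ‖u - 1‖ := add_le_add (norm_mul_le _ _) (norm_mul_le _ _)
    _ = 2 * ‖u - 1‖ * ‖v - 1‖ := by ring

/-- The PLAQUETTE IDENTITY: for `u₃u₃′ = 1`, `u₄u₄′ = 1`,
`u₁u₂u₃′u₄′ − 1 = ((u₁ − u₃)u₂ + u₃(u₂ − u₄) + (u₃u₄ − u₄u₃))·(u₃′u₄′)` (the plaquette variable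
`U(∂p)` of B7 (52) written through the bond variables of B9 (3.35)). [folklore] -/
theorem plaq_sub_one_eq (u₁ u₂ u₃ u₄ u₃' u₄' : 𝔸) (h₃ : u₃ * u₃' = 1) (h₄ : u₄ * u₄' = 1) :
    u₁ * u₂ * u₃' * u₄' - 1
      = ((u₁ - u₃) * u₂ + u₃ * (u₂ - u₄) + (u₃ * u₄ - u₄ * u₃)) * (u₃' * u₄') := by
  calc u₁ * u₂ * u₃' * u₄' - 1
      = u₁ * u₂ * u₃' * u₄' - u₄ * (u₃ * u₃') * u₄' := by rw [h₃, mul_one, h₄]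
    _ = ((u₁ - u₃) * u₂ + u₃ * (u₂ - u₄) + (u₃ * u₄ - u₄ * u₃)) * (u₃' * u₄') := by
        noncomm_ring

/-- General norm bound for the plaquette. [folklore] -/
theorem norm_plaq_sub_one_le (u₁ u₂ u₃ u₄ u₃' u₄' : 𝔸) (h₃ : u₃ * u₃' = 1)
    (h₄ : u₄ * u₄' = 1) :
    ‖u₁ * u₂ * u₃' * u₄' - 1‖
      ≤ (‖u₁ - u₃‖ * ‖u₂‖ + ‖u₃‖ * ‖u₂ - u₄‖ + 2 * ‖u₃ - 1‖ * ‖u₄ - 1‖)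
          * (‖u₃'‖ * ‖u₄'‖) := by
  rw [plaq_sub_one_eq u₁ u₂ u₃ u₄ u₃' u₄' h₃ h₄]
  refine (norm_mul_le _ _).trans ?_
  have hA : ‖(u₁ - u₃) * u₂ + u₃ * (u₂ - u₄) + (u₃ * u₄ - u₄ * u₃)‖
      ≤ ‖u₁ - u₃‖ * ‖u₂‖ + ‖u₃‖ * ‖u₂ - u₄‖ + 2 * ‖u₃ - 1‖ * ‖u₄ - 1‖ := by
    calc ‖(u₁ - u₃) * u₂ + u₃ * (u₂ - u₄) + (u₃ * u₄ - u₄ * u₃)‖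
        ≤ ‖(u₁ - u₃) * u₂‖ + ‖u₃ * (u₂ - u₄)‖ + ‖u₃ * u₄ - u₄ * u₃‖ := norm_add₃_le
      _ ≤ ‖u₁ - u₃‖ * ‖u₂‖ + ‖u₃‖ * ‖u₂ - u₄‖ + 2 * ‖u₃ - 1‖ * ‖u₄ - 1‖ :=
          add_le_add (add_le_add (norm_mul_le _ _) (norm_mul_le _ _)) (norm_comm_le _ _)
  have hB : ‖u₃' * u₄'‖ ≤ ‖u₃'‖ * ‖u₄'‖ := norm_mul_le _ _
  exact mul_le_mul hA hB (norm_nonneg _) (by positivity)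

/-- The UNITARY-TYPE bound (all factors of norm `≤ 1`, e.g. values in a compact group `G ⊂ U(n)`):
`‖u₁u₂u₃′u₄′ − 1‖ ≤ ‖u₁ − u₃‖ + ‖u₂ − u₄‖ + 2‖u₃ − 1‖‖u₄ − 1‖`. [folklore] -/
theorem norm_plaq_sub_one_le_of_norm_le_one (u₁ u₂ u₃ u₄ u₃' u₄' : 𝔸) (h₃ : u₃ * u₃' = 1)
    (h₄ : u₄ * u₄' = 1) (n₂ : ‖u₂‖ ≤ 1) (n₃ : ‖u₃‖ ≤ 1) (n₃' : ‖u₃'‖ ≤ 1) (n₄' : ‖u₄'‖ ≤ 1) :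
    ‖u₁ * u₂ * u₃' * u₄' - 1‖ ≤ ‖u₁ - u₃‖ + ‖u₂ - u₄‖ + 2 * ‖u₃ - 1‖ * ‖u₄ - 1‖ := by
  refine (norm_plaq_sub_one_le u₁ u₂ u₃ u₄ u₃' u₄' h₃ h₄).trans ?_
  have h34 : ‖u₃'‖ * ‖u₄'‖ ≤ 1 := by
    calc ‖u₃'‖ * ‖u₄'‖ ≤ 1 * 1 := mul_le_mul n₃' n₄' (norm_nonneg _) zero_le_one
      _ = 1 := one_mul 1
  calc (‖u₁ - u₃‖ * ‖u₂‖ + ‖u₃‖ * ‖u₂ - u₄‖ + 2 * ‖u₃ - 1‖ * ‖u₄ - 1‖) * (‖u₃'‖ * ‖u₄'‖)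
      ≤ (‖u₁ - u₃‖ * 1 + 1 * ‖u₂ - u₄‖ + 2 * ‖u₃ - 1‖ * ‖u₄ - 1‖) * 1 := by
        gcongr
    _ = ‖u₁ - u₃‖ + ‖u₂ - u₄‖ + 2 * ‖u₃ - 1‖ * ‖u₄ - 1‖ := by ring

/-- GAUGE INVARIANCE of `‖U(∂p) − 1‖`: `U^u(∂p) = u(x)U(∂p)u(x)^{-1}` with `‖u(x)‖, ‖u(x)^{-1}‖ ≤ 1`
(values in `G`) has the same distance to `1` (B9 p. 396: (3.35) is imposed in a gauge `u` on □;
cf. (3.33)–(3.34)). [folklore] -/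
theorem norm_conj_sub_one_eq (w x w' : 𝔸) (hw : w * w' = 1) (hw' : w' * w = 1) (nw : ‖w‖ ≤ 1)
    (nw' : ‖w'‖ ≤ 1) : ‖w * x * w' - 1‖ = ‖x - 1‖ := by
  refine le_antisymm (B7Transfer.norm_conj_sub_one_le w x w' hw nw nw') ?_
  have h : w' * (w * x * w') * w = x := by
    calc w' * (w * x * w') * w = (w' * w) * x * (w' * w) := by noncomm_ring
      _ = x := by rw [hw', one_mul, mul_one]
  calc ‖x - 1‖ = ‖w' * (w * x * w') * w - 1‖ := by rw [h]
    _ ≤ ‖w * x * w' - 1‖ := B7Transfer.norm_conj_sub_one_le w' _ w hw' nw' nw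

/-- Covariant versus ordinary difference: `u a u′ − a = ([u − 1, a])·u′` for `uu′ = 1`. [folklore] -/
theorem conj_sub_self_eq (u a u' : 𝔸) (hu : u * u' = 1) :
    u * a * u' - a = ((u - 1) * a - a * (u - 1)) * u' := by
  calc u * a * u' - a = u * a * u' - a * (u * u') := by rw [hu, mul_one]
    _ = ((u - 1) * a - a * (u - 1)) * u' := by noncomm_ring

/-- `‖u a u′ − a‖ ≤ 2‖u − 1‖‖a‖‖u′‖`: the term by which the covariant derivative `η^{-1}(R(U_b)a′ − a)` of
B9 (3.39) differs from the ordinary one `η^{-1}(a′ − a)` is `η^{-1}(R(U_b)a′ − a′)`, of norm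
`≤ 2η^{-1}‖U_b − 1‖‖a′‖` for `G`-valued `U_b`. [folklore] -/
theorem norm_conj_sub_self_le (u a u' : 𝔸) (hu : u * u' = 1) :
    ‖u * a * u' - a‖ ≤ 2 * ‖u - 1‖ * ‖a‖ * ‖u'‖ := by
  rw [conj_sub_self_eq u a u' hu]
  calc ‖((u - 1) * a - a * (u - 1)) * u'‖ ≤ ‖(u - 1) * a - a * (u - 1)‖ * ‖u'‖ := norm_mul_le _ _
    _ ≤ (‖(u - 1) * a‖ + ‖a * (u - 1)‖) * ‖u'‖ := by gcongr; exact norm_sub_le _ _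
    _ ≤ (‖u - 1‖ * ‖a‖ + ‖a‖ * ‖u - 1‖) * ‖u'‖ := by
        gcongr <;> exact norm_mul_le _ _
    _ = 2 * ‖u - 1‖ * ‖a‖ * ‖u'‖ := by ring

end Ring

/-! ## §2  The factors as exponentials (no unitarity assumed) -/

section Exp

open NormedSpace

variable {𝔄 : Type*} [NormedRing 𝔄] [NormedAlgebra ℂ 𝔄] [NormedAlgebra ℚ 𝔄] [CompleteSpace 𝔄]
  [NormOneClass 𝔄]

omit [NormedAlgebra ℚ 𝔄] in
/-- `‖e^X − 1‖ ≤ ‖X‖e^{‖X‖}` (from the tree's Lipschitz lemma at `Y = 0`). [folklore] -/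
theorem norm_exp_sub_one_le_mul (X : 𝔄) : ‖exp X - 1‖ ≤ ‖X‖ * Real.exp ‖X‖ := by
  have h := Literature.Analysis.Complex.norm_exp_sub_exp_le X 0
  rwa [exp_zero, sub_zero, norm_zero, max_eq_left (norm_nonneg X)] at h

omit [NormedAlgebra ℚ 𝔄] in
/-- `‖e^X − e^Y‖ ≤ ‖X − Y‖e^s` when `‖X‖, ‖Y‖ ≤ s`. [folklore] -/
theorem norm_exp_sub_exp_le_of_le (X Y : 𝔄) {s : ℝ} (hX : ‖X‖ ≤ s) (hY : ‖Y‖ ≤ s) :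
    ‖exp X - exp Y‖ ≤ ‖X - Y‖ * Real.exp s := by
  refine (Literature.Analysis.Complex.norm_exp_sub_exp_le X Y).trans ?_
  gcongr
  exact max_le hX hY

omit [NormedAlgebra ℚ 𝔄] in
/-- `‖e^{X}‖ ≤ e^s` when `‖X‖ ≤ s`. [folklore] -/
theorem norm_exp_le_of_le (X : 𝔄) {s : ℝ} (hX : ‖X‖ ≤ s) : ‖exp X‖ ≤ Real.exp s :=
  (Literature.Analysis.Complex.norm_exp_le_exp_norm X).trans (Real.exp_le_exp.mpr hX)

omit [NormedAlgebra ℚ 𝔄] in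
/-- `‖e^{-X}‖ ≤ e^s` when `‖X‖ ≤ s`. [folklore] -/
theorem norm_exp_neg_le_of_le (X : 𝔄) {s : ℝ} (hX : ‖X‖ ≤ s) : ‖exp (-X)‖ ≤ Real.exp s :=
  norm_exp_le_of_le (-X) (by rwa [norm_neg])

/-- THE PLAQUETTE BOUND through exponentials, hypothesis-free apart from the sizes:
`‖X_i‖ ≤ s` (i = 1, …, 4), `‖X₁ − X₃‖ ≤ δ`, `‖X₂ − X₄‖ ≤ δ` give
`‖e^{X₁}e^{X₂}e^{-X₃}e^{-X₄} − 1‖ ≤ 2(δ + s²)e^{4s}`. [folklore] -/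
theorem norm_plaquette_exp_sub_one_le (X₁ X₂ X₃ X₄ : 𝔄) {s δ : ℝ} (h₁ : ‖X₁‖ ≤ s)
    (h₂ : ‖X₂‖ ≤ s) (h₃ : ‖X₃‖ ≤ s) (h₄ : ‖X₄‖ ≤ s) (h₁₃ : ‖X₁ - X₃‖ ≤ δ)
    (h₂₄ : ‖X₂ - X₄‖ ≤ δ) :
    ‖exp X₁ * exp X₂ * exp (-X₃) * exp (-X₄) - 1‖ ≤ 2 * (δ + s ^ 2) * Real.exp (4 * s) := by
  have hs : 0 ≤ s := (norm_nonneg _).trans h₁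
  have hδ : 0 ≤ δ := (norm_nonneg _).trans h₁₃
  have key := norm_plaq_sub_one_le (exp X₁) (exp X₂) (exp X₃) (exp X₄) (exp (-X₃)) (exp (-X₄))
    (Literature.Analysis.Complex.exp_mul_exp_neg X₃) (Literature.Analysis.Complex.exp_mul_exp_neg X₄)
  refine key.trans ?_
  have e13 : ‖exp X₁ - exp X₃‖ ≤ δ * Real.exp s :=
    (norm_exp_sub_exp_le_of_le X₁ X₃ h₁ h₃).trans (by gcongr)
  have e24 : ‖exp X₂ - exp X₄‖ ≤ δ * Real.exp s :=
    (norm_exp_sub_exp_le_of_le X₂ X₄ h₂ h₄).trans (by gcongr)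
  have e3 : ‖exp X₃ - 1‖ ≤ s * Real.exp s :=
    (norm_exp_sub_one_le_mul X₃).trans (by gcongr)
  have e4 : ‖exp X₄ - 1‖ ≤ s * Real.exp s :=
    (norm_exp_sub_one_le_mul X₄).trans (by gcongr)
  have n2 := norm_exp_le_of_le X₂ h₂
  have n3 := norm_exp_le_of_le X₃ h₃
  have n3' := norm_exp_neg_le_of_le X₃ h₃
  have n4' := norm_exp_neg_le_of_le X₄ h₄
  calc (‖exp X₁ - exp X₃‖ * ‖exp X₂‖ + ‖exp X₃‖ * ‖exp X₂ - exp X₄‖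
          + 2 * ‖exp X₃ - 1‖ * ‖exp X₄ - 1‖) * (‖exp (-X₃)‖ * ‖exp (-X₄)‖)
      ≤ (δ * Real.exp s * Real.exp s + Real.exp s * (δ * Real.exp s)
          + 2 * (s * Real.exp s) * (s * Real.exp s)) * (Real.exp s * Real.exp s) := by
        gcongr
    _ = 2 * (δ + s ^ 2) * (Real.exp s * Real.exp s * Real.exp s * Real.exp s) := by ring
    _ = 2 * (δ + s ^ 2) * Real.exp (4 * s) := by
        have : Real.exp (4 * s) = Real.exp s * Real.exp s * Real.exp s * Real.exp s := by
          rw [show 4 * s = s + s + s + s by ring, Real.exp_add, Real.exp_add, Real.exp_add]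
        rw [this]

/-! ## §3  B9 (3.35) ⇒ B7 (52) at ratio `ξ = L^{-j}` -/

/-- With `s = Cξ` and `δ = Cξ²` (`C = O(1)Mα₀ ≥ 0`, `0 ≤ ξ ≤ 1`):
`‖U(∂p) − 1‖ ≤ 2C(1 + C)e^{4C}·ξ²` — B7 (52) at ratio `ξ` with `α₀′ = 2C(1 + C)e^{4C}`; the implicit step
behind B9 p. 401 "Applying the inequalities (161), (162) [5]" / "By Proposition 4 [5]" (GAPS C-b07g7-3 H1).
[cite: Balaban1985BackgroundPropagators, (3.35) p.396; p.401 after (3.57)]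
[cite: Balaban1985Averaging, (52) p.26; Prop. 2 p.26] -/
theorem b7_52_of_b9_335 (X₁ X₂ X₃ X₄ : 𝔄) {C ξ : ℝ} (hC : 0 ≤ C) (hξ0 : 0 ≤ ξ) (hξ1 : ξ ≤ 1)
    (h₁ : ‖X₁‖ ≤ C * ξ) (h₂ : ‖X₂‖ ≤ C * ξ) (h₃ : ‖X₃‖ ≤ C * ξ) (h₄ : ‖X₄‖ ≤ C * ξ)
    (h₁₃ : ‖X₁ - X₃‖ ≤ C * ξ ^ 2) (h₂₄ : ‖X₂ - X₄‖ ≤ C * ξ ^ 2) :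
    ‖exp X₁ * exp X₂ * exp (-X₃) * exp (-X₄) - 1‖
      ≤ (2 * C * (1 + C) * Real.exp (4 * C)) * ξ ^ 2 := by
  refine (norm_plaquette_exp_sub_one_le X₁ X₂ X₃ X₄ h₁ h₂ h₃ h₄ h₁₃ h₂₄).trans ?_
  have hξ2 : ξ ^ 2 ≤ ξ := by nlinarith
  have hexp : Real.exp (4 * (C * ξ)) ≤ Real.exp (4 * C) := by
    apply Real.exp_le_exp.mpr; nlinarith
  calc 2 * (C * ξ ^ 2 + (C * ξ) ^ 2) * Real.exp (4 * (C * ξ))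
      ≤ 2 * (C * ξ ^ 2 + (C * ξ) ^ 2) * Real.exp (4 * C) := by gcongr
    _ = (2 * C * ξ ^ 2 + 2 * C * (C * ξ ^ 2)) * Real.exp (4 * C) := by ring
    _ ≤ (2 * C * ξ ^ 2 + 2 * C * (C * ξ ^ 2)) * Real.exp (4 * C) := le_rfl
    _ = (2 * C * (1 + C) * Real.exp (4 * C)) * ξ ^ 2 := by ring

/-- The shape of B7 (52) itself: `‖U(∂p) − 1‖ ≤ α₀′ξ²` with an admissible `α₀′`.
[cite: Balaban1985Averaging, (52) p.26] [cite: Balaban1985BackgroundPropagators, (3.35) p.396] -/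
theorem b7_52_shape (X₁ X₂ X₃ X₄ : 𝔄) {C ξ : ℝ} (hC : 0 ≤ C) (hξ0 : 0 ≤ ξ) (hξ1 : ξ ≤ 1)
    (h₁ : ‖X₁‖ ≤ C * ξ) (h₂ : ‖X₂‖ ≤ C * ξ) (h₃ : ‖X₃‖ ≤ C * ξ) (h₄ : ‖X₄‖ ≤ C * ξ)
    (h₁₃ : ‖X₁ - X₃‖ ≤ C * ξ ^ 2) (h₂₄ : ‖X₂ - X₄‖ ≤ C * ξ ^ 2) :
    ∃ α₀' : ℝ, 0 ≤ α₀' ∧ α₀' ≤ 2 * C * (1 + C) * Real.exp (4 * C) ∧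
      ‖exp X₁ * exp X₂ * exp (-X₃) * exp (-X₄) - 1‖ ≤ α₀' * ξ ^ 2 :=
  ⟨2 * C * (1 + C) * Real.exp (4 * C), by positivity, le_rfl,
    b7_52_of_b9_335 X₁ X₂ X₃ X₄ hC hξ0 hξ1 h₁ h₂ h₃ h₄ h₁₃ h₂₄⟩

omit [NormedAlgebra ℚ 𝔄] [CompleteSpace 𝔄] [NormOneClass 𝔄] in
/-- Bond dictionary: `‖iηa‖ = η‖a‖` for `η ≥ 0` (B9 p. 396 "U^u = e^{iηA}"). [folklore] -/
theorem norm_bond (a : 𝔄) {η : ℝ} (hη : 0 ≤ η) :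
    ‖(Complex.I * (η : ℂ)) • a‖ = η * ‖a‖ := by
  rw [norm_smul, norm_mul, Complex.norm_I, one_mul, Complex.norm_real, Real.norm_of_nonneg hη]

omit [NormedAlgebra ℚ 𝔄] [CompleteSpace 𝔄] [NormOneClass 𝔄] in
/-- Bond dictionary: `X₁ − X₃ = iη(a₁ − a₃)` has norm `η²·‖η^{-1}(a₃ − a₁)‖ = η²|(∇_νA_μ)(x)|`
(`a₁ = A_μ(x)`, `a₃ = A_μ(x + ηe_ν)`, ordinary lattice gradient). [folklore] -/
theorem norm_bond_sub (a₁ a₃ : 𝔄) {η : ℝ} (hη : 0 < η) :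
    ‖(Complex.I * (η : ℂ)) • a₁ - (Complex.I * (η : ℂ)) • a₃‖ = η ^ 2 * ‖(η⁻¹ : ℝ) • (a₃ - a₁)‖ := by
  rw [← smul_sub, norm_bond _ hη.le, norm_smul, Real.norm_of_nonneg (inv_nonneg.mpr hη.le),
    norm_sub_rev a₃ a₁]
  field_simp

omit [NormedAlgebra ℚ 𝔄] [CompleteSpace 𝔄] [NormOneClass 𝔄] in
/-- (3.35) in its printed form ⇒ the hypotheses of `b7_52_of_b9_335` for one plaquette:
`|A_b| ≤ C′(L^jη)^{-1}` on the four bonds and `|∇A| ≤ C′(L^jη)^{-2}` on the two relevant gradients give,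
for `X_b = iηA_b` and `ξ = η/(L^jη)`, `‖X_b‖ ≤ C′ξ` and `‖X₁ − X₃‖, ‖X₂ − X₄‖ ≤ C′ξ²`.
[cite: Balaban1985BackgroundPropagators, (3.35) p.396] -/
theorem hyps_of_335 (a : 𝔄) (a₁ a₃ : 𝔄) {η ℓ C : ℝ} (hη : 0 < η)
    (ha : ‖a‖ ≤ C * ℓ⁻¹) (hgrad : ‖(η⁻¹ : ℝ) • (a₃ - a₁)‖ ≤ C * (ℓ⁻¹) ^ 2) :
    ‖(Complex.I * (η : ℂ)) • a‖ ≤ C * (η / ℓ) ∧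
      ‖(Complex.I * (η : ℂ)) • a₁ - (Complex.I * (η : ℂ)) • a₃‖ ≤ C * (η / ℓ) ^ 2 := by
  constructor
  · rw [norm_bond a hη.le]
    calc η * ‖a‖ ≤ η * (C * ℓ⁻¹) := by gcongr
      _ = C * (η / ℓ) := by ring
  · rw [norm_bond_sub a₁ a₃ hη]
    calc η ^ 2 * ‖(η⁻¹ : ℝ) • (a₃ - a₁)‖ ≤ η ^ 2 * (C * (ℓ⁻¹) ^ 2) := by gcongr
      _ = C * (η / ℓ) ^ 2 := by ring

end Exp

end Literature.MathematicalPhysics.QuantumFieldTheory.Balaban1983to89.B9Eq335Plaquette
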